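import Summits.ResolutionOfSingularities.ResolutionOfSingularities.Theorems.WildCocycleLU2
import HarnessLib
/-!
# WildCocycleLU (3/4) — THE EXACT CARVE `λ″ ↔ λ₁ ∨ λ₂` and the LOCATION `λ″ ∧ ¬λ₁ → λ₂`

Node «CocycleCut» (decomp-res lens-1 g34), tree file 3/4.

* `cyclic_or_rankTwo` — the PER-MODEL DICHOTOMY: a `λ″`-frame on a `G`-stable model either RESCALES (by units of
  `B = M_𝔪′`) to a single-principal-unit frame (grade 1: all frame cocycles on one `F_p`-line of `H¹(⟨g⟩, B^×)`;
  grade 0 excluded by Nakayama, file 1) or carries an `F_p`-independent pair of frame cocycles (grade ≥ 2).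
* `modelAbove_sup_adjoin_eq` — f.g. birational models are DIRECTED and `(R ⊔ k[s₀])[t] = R[t ∪ ι s₀]` upstairs,
  so the `∀ R ∃ model` kinds inherit the per-model dichotomy.
* `wildLogDiagonalMixedAbove_iff : WildLogDiagonalMixedAbove k O ↔ WildLogCyclicAbove k O ∨ WildLogRankTwoAbove k O`
  (hypothesis-free) and `wildLogRankTwoAbove_of_not_cyclic` (the remainder of the log-diagonal world IS grade ≥ 2).
-/

noncomputable section
open IsLocalRing IntermediateField Literature.AlgebraicGeometry.Resolution
open Summit.ResolutionOfSingularities.ResolutionOfSingularities.Theorems.WildReflectionLU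
open Summit.ResolutionOfSingularities.ResolutionOfSingularities.Theorems.WildLogDiagonalLU
open Summit.ResolutionOfSingularities.ResolutionOfSingularities.Theorems.TameQuotientLU

universe u

namespace Summit.ResolutionOfSingularities.ResolutionOfSingularities.Theorems.WildCocycleLU

/-! ## The per-model dichotomy -/
section Model

variable (k : Type) [Field k] {K : Type} [Field K] {K' : Type} [Field K'] [Algebra K K'] [Algebra k K']

set_option maxHeartbeats 1600000 in
/-- **PER-MODEL DICHOTOMY (grade 1 ∨ grade ≥ 2).**  On a `g`-stable model `M ⊆ O′` containing the constants `k`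
(residues of `O′` in `k`, `g` of order `p = char`, preserving `O′`), a mixed-unit log-diagonal frame
(`x = x′^A` generating the centre of `B = M_𝔪′`, `g x′_j = x′_j u_j`, `u_j ∈ B^×`, a moved coordinate) EITHER has
an `F_p`-INDEPENDENT PAIR of cocycles `u_{j₁}, u_{j₂}` (grade ≥ 2), OR all pairs are dependent and then: some
`u_{j₁}` is not a unit coboundary (else the frame rescales to a `g`-fixed one and `g = id` on `B` by Nakayama —
`apply_eq_self_of_apply_generators_eq` — contradicting the moved coordinate), every `u_j ≡ u_{j₁}^{N_j}` modulo
unit coboundaries `gφ_j/φ_j` (`exists_zpow_div_isUnitCoboundary`), and the RESCALED frame `x″_j = x′_j φ_j`,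
`x̃ = x″^A = x·unit` satisfies (F2)–(F5) with the SINGLE principal unit `u_{j₁} = 1 + η`, `η ∈ B`,
`v′(η) < 1` (norm one + residues + Frobenius: `valuation_sub_one_lt_of_norm_eq_one`), and `x″_{j₁}` is moved.
[folklore] -/
theorem cyclic_or_rankTwo (p : ℕ) [hp : Fact p.Prime] [CharP K' p] (O' : ValuationSubring K')
    (hκ' : ∀ y ∈ O', ∃ c : k, y - algebraMap k K' c ∈ O'.nonunits)
    (g : K' ≃ₐ[K] K') (hσO : ∀ z : K', z ∈ O' ↔ g z ∈ O') (hσp : (g : K' ≃+* K') ^ p = 1)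
    (hgk : ∀ c : k, g (algebraMap k K' c) = algebraMap k K' c)
    {M : Subring K'} (hMO : M ≤ O'.toSubring) (hσM : ∀ z ∈ M, g z ∈ M)
    (hkM : ∀ c : k, algebraMap k K' c ∈ M) (hreg : IsRegularLocalRing (locAtCentre M O'))
    {d : ℕ} {x x' : Fin d → K'} {A : Fin d → Fin d → ℕ}
    (hx : ∀ i, x i ∈ locAtCentre M O' ∧ O'.valuation (x i) < 1)
    (hgen : ∀ b ∈ locAtCentre M O', O'.valuation b < 1 →
      ∃ c : Fin d → K', (∀ i, c i ∈ locAtCentre M O') ∧ b = ∑ i, c i * x i)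
    (hx' : ∀ j, x' j ≠ 0 ∧ x' j ∈ O' ∧ O'.valuation (x' j) < 1 ∧
      ∃ a b : K', a ∈ M ∧ b ∈ M ∧ x' j = a / b)
    (hmon : ∀ i, x i = ∏ j, x' j ^ A i j)
    (hu : ∀ j, ∃ u : K', u ∈ locAtCentre M O' ∧ u⁻¹ ∈ locAtCentre M O' ∧ g (x' j) = x' j * u)
    (hmv : ∃ j, g (x' j) ≠ x' j) :
    (∃ x₁ x₁' : Fin d → K', ∃ A₁ : Fin d → Fin d → ℕ, ∃ η : K', ∃ N : Fin d → ℤ,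
      (∀ i, x₁ i ∈ locAtCentre M O' ∧ O'.valuation (x₁ i) < 1) ∧
      (∀ b ∈ locAtCentre M O', O'.valuation b < 1 →
        ∃ c : Fin d → K', (∀ i, c i ∈ locAtCentre M O') ∧ b = ∑ i, c i * x₁ i) ∧
      (∀ j, x₁' j ≠ 0 ∧ x₁' j ∈ O' ∧ O'.valuation (x₁' j) < 1 ∧
        ∃ a b : K', a ∈ M ∧ b ∈ M ∧ x₁' j = a / b) ∧
      (∀ i, x₁ i = ∏ j, x₁' j ^ A₁ i j) ∧
      (η ∈ locAtCentre M O' ∧ O'.valuation η < 1) ∧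
      (∀ j, g (x₁' j) = x₁' j * (1 + η) ^ (N j)) ∧
      ∃ j, g (x₁' j) ≠ x₁' j) ∨
    (∃ j₁ j₂ : Fin d, ∀ a b : ℤ, ∀ φ : K', φ ∈ locAtCentre M O' → φ⁻¹ ∈ locAtCentre M O' →
      (g (x' j₁) / x' j₁) ^ a * (g (x' j₂) / x' j₂) ^ b = g φ / φ → (p : ℤ) ∣ a ∧ (p : ℤ) ∣ b) := by
  classical
  haveI := hreg
  set B : Subring K' := locAtCentre M O' with hBdef
  set σ : K' ≃+* K' := (g : K' ≃+* K') with hσdef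
  have hσg : ∀ z, σ z = g z := fun _ => rfl
  have hσO' : ∀ z : K', z ∈ O' ↔ σ z ∈ O' := hσO
  have hσM' : ∀ z ∈ M, σ z ∈ M := hσM
  have hσB : ∀ z ∈ B, σ z ∈ B := fun z hz => apply_mem_locAtCentre O' hσO' hσM' hz
  have hBO : B ≤ O'.toSubring := locAtCentre_le hMO
  have hvB : ∀ z ∈ B, O'.valuation z ≤ 1 := fun z hz => (O'.valuation_le_one_iff _).mpr (hBO hz)
  have hx'0 : ∀ j, x' j ≠ 0 := fun j => (hx' j).1
  have hres : ∀ b ∈ B, ∃ c ∈ B, σ c = c ∧ O'.valuation (b - c) < 1 := by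
    intro b hb
    obtain ⟨c, hc⟩ := hκ' b (hBO hb)
    exact ⟨algebraMap k K' c, le_locAtCentre M O' (hkM c), hgk c, (O'.mem_nonunits_iff).mp hc⟩
  -- products of unit powers
  have hPB : ∀ (φ : Fin d → K') (i : Fin d), (∀ j, φ j ∈ B) → (∏ j, φ j ^ A i j) ∈ B :=
    fun φ i hφ => prod_mem fun j _ => pow_mem (hφ j) _
  have hPi : ∀ (φ : Fin d → K') (i : Fin d), (∀ j, (φ j)⁻¹ ∈ B) → (∏ j, φ j ^ A i j)⁻¹ ∈ B := by
    intro φ i hφ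
    rw [← Finset.prod_inv_distrib]
    exact prod_mem fun j _ => by rw [← inv_pow]; exact pow_mem (hφ j) _
  have hP0 : ∀ (φ : Fin d → K') (i : Fin d), (∀ j, φ j ≠ 0) → (∏ j, φ j ^ A i j) ≠ 0 :=
    fun φ i hφ => Finset.prod_ne_zero_iff.mpr fun j _ => pow_ne_zero _ (hφ j)
  -- the frame cocycles `u_j = g x′_j / x′_j`
  choose uu huB hui hgu using hu
  have hu0 : ∀ j, uu j ≠ 0 := by
    intro j h0
    have e := hgu j; rw [h0, mul_zero] at e
    exact hx'0 j ((EmbeddingLike.map_eq_zero_iff (f := g)).mp e)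
  have huu : ∀ j, uu j = σ (x' j) / x' j := fun j => by
    rw [hσg, hgu j, mul_div_cancel_left₀ _ (hx'0 j)]
  have hnormu : ∀ j, ∏ i ∈ Finset.range p, (σ ^ i) (uu j) = 1 := fun j => by
    rw [huu j]; exact norm_apply_div_eq_one hσp (hx'0 j)
  have hup : ∀ j, IsUnitCoboundary B σ (uu j ^ p) := fun j =>
    isUnitCoboundary_pow_of_norm_eq_one hσB hσp (hu0 j) (huB j) (hui j) (hnormu j)
  -- the dichotomy
  by_cases hind : ∃ j₁ j₂ : Fin d, ∀ a b : ℤ, ∀ φ : K', φ ∈ B → φ⁻¹ ∈ B →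
      (g (x' j₁) / x' j₁) ^ a * (g (x' j₂) / x' j₂) ^ b = g φ / φ → (p : ℤ) ∣ a ∧ (p : ℤ) ∣ b
  · exact Or.inr hind
  left
  have hdep : ∀ j₁ j₂ : Fin d, ∃ a b : ℤ, ¬ ((p : ℤ) ∣ a ∧ (p : ℤ) ∣ b) ∧
      IsUnitCoboundary B σ (uu j₁ ^ a * uu j₂ ^ b) := by
    intro j₁ j₂
    by_contra hcon
    refine hind ⟨j₁, j₂, fun a b φ hφ hφi he => ?_⟩
    by_contra hab
    have hφ0 : φ ≠ 0 := by
      rintro rfl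
      rw [map_zero, div_zero] at he
      refine mul_ne_zero (zpow_ne_zero a ?_) (zpow_ne_zero b ?_) he
      · exact div_ne_zero ((map_ne_zero g).mpr (hx'0 j₁)) (hx'0 j₁)
      · exact div_ne_zero ((map_ne_zero g).mpr (hx'0 j₂)) (hx'0 j₂)
    exact hcon ⟨a, b, hab, φ, hφ0, hφ, hφi, by rw [huu j₁, huu j₂]; exact he⟩
  -- GRADE 0 IS EMPTY: some frame cocycle is not a unit coboundary
  have hex : ∃ j₁, ¬ IsUnitCoboundary B σ (uu j₁) := by
    by_contra hnone
    simp only [not_exists, not_not] at hnone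
    choose φ hφ0 hφB hφi hφe using hnone
    let y : Fin d → K' := fun i => x i * (∏ j, φ j ^ A i j)⁻¹
    have hyB : ∀ i, y i ∈ B ∧ O'.valuation (y i) < 1 := fun i =>
      ⟨mul_mem (hx i).1 (hPi φ i hφi), by
        show O'.valuation (x i * (∏ j, φ j ^ A i j)⁻¹) < 1
        rw [map_mul]
        exact mul_lt_one_of_lt_of_le (hx i).2 (hvB _ (hPi φ i hφi))⟩
    have hygen : ∀ b ∈ B, O'.valuation b < 1 →
        ∃ c : Fin d → K', (∀ i, c i ∈ B) ∧ b = ∑ i, c i * y i := by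
      intro b hb hvb
      obtain ⟨c, hcB, rfl⟩ := hgen b hb hvb
      refine ⟨fun i => c i * ∏ j, φ j ^ A i j, fun i => mul_mem (hcB i) (hPB φ i hφB),
        Finset.sum_congr rfl fun i _ => ?_⟩
      have h0 := hP0 φ i hφ0
      show c i * x i = c i * (∏ j, φ j ^ A i j) * (x i * (∏ j, φ j ^ A i j)⁻¹)
      field_simp
    have hyfix : ∀ i, σ (y i) = y i := by
      intro i
      have e1 : σ (x i) = x i * ∏ j, (σ (φ j) / φ j) ^ A i j := by
        rw [hmon i, map_prod, ← Finset.prod_mul_distrib]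
        refine Finset.prod_congr rfl fun j _ => ?_
        rw [map_pow, show σ (x' j) = x' j * (σ (φ j) / φ j) by rw [hσg, hgu j, hφe j], mul_pow]
      have h0 := hP0 φ i hφ0
      have h0' : (∏ j, σ (φ j) ^ A i j) ≠ 0 :=
        Finset.prod_ne_zero_iff.mpr fun j _ => pow_ne_zero _ ((map_ne_zero σ).mpr (hφ0 j))
      show σ (x i * (∏ j, φ j ^ A i j)⁻¹) = x i * (∏ j, φ j ^ A i j)⁻¹
      rw [map_mul, map_inv₀, map_prod, e1]
      simp_rw [map_pow, div_pow, Finset.prod_div_distrib]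
      field_simp
    have hfixB : ∀ b ∈ B, σ b = b :=
      apply_eq_self_of_apply_generators_eq O' hMO hσO' hσM' hyB hygen hres hyfix
    obtain ⟨j₀, hj₀⟩ := hmv
    apply hj₀
    obtain ⟨a, b, ha, hb, e⟩ := (hx' j₀).2.2.2
    rw [e, map_div₀, show g a = a from hfixB a (le_locAtCentre M O' ha),
      show g b = b from hfixB b (le_locAtCentre M O' hb)]
  -- THE CYCLIC PRESENTATION and the rescaled single-unit frame
  obtain ⟨j₁, hj₁⟩ := hex
  obtain ⟨N, hN⟩ := exists_zpow_div_isUnitCoboundary hp.out hu0 hup hj₁ (hdep j₁)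
  choose φ hφ0 hφB hφi hφe using hN
  have hxx : ∀ i, (∏ j, (x' j * φ j) ^ A i j) = x i * ∏ j, φ j ^ A i j := fun i => by
    rw [hmon i, ← Finset.prod_mul_distrib]
    exact Finset.prod_congr rfl fun j _ => mul_pow _ _ _
  have hσφ : ∀ j, σ (φ j) = uu j₁ ^ N j / uu j * φ j := fun j => (div_eq_iff (hφ0 j)).mp (hφe j).symm
  have htw : ∀ j, σ (x' j * φ j) = x' j * φ j * uu j₁ ^ N j := by
    intro j
    have h0 := hu0 j
    rw [map_mul, hσφ j, hσg, hgu j]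
    field_simp
  have hC : ∀ c ∈ (algebraMap k K').fieldRange, c ∈ O' ∧ σ c = c := by
    intro c hc
    obtain ⟨c₀, rfl⟩ := RingHom.mem_fieldRange.mp hc
    exact ⟨hMO (hkM c₀), hgk c₀⟩
  have hηv : O'.valuation (uu j₁ - 1) < 1 := by
    obtain ⟨c₀, hc₀⟩ := hκ' _ (hBO (huB j₁))
    exact valuation_sub_one_lt_of_norm_eq_one O' p hσO' (algebraMap k K').fieldRange (fun c hc => (hC c hc).1)
      (fun c hc => (hC c hc).2) (hBO (huB j₁))
      ⟨_, RingHom.mem_fieldRange.mpr ⟨c₀, rfl⟩, (O'.mem_nonunits_iff).mp hc₀⟩ (hnormu j₁)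
  refine ⟨fun i => ∏ j, (x' j * φ j) ^ A i j, fun j => x' j * φ j, A, uu j₁ - 1, N, ?_, ?_, ?_,
    fun i => rfl, ⟨B.sub_mem (huB j₁) B.one_mem, hηv⟩, ?_, ?_⟩
  · intro i
    show (∏ j, (x' j * φ j) ^ A i j) ∈ B ∧ O'.valuation (∏ j, (x' j * φ j) ^ A i j) < 1
    rw [hxx i, map_mul]
    exact ⟨mul_mem (hx i).1 (hPB φ i hφB), mul_lt_one_of_lt_of_le (hx i).2 (hvB _ (hPB φ i hφB))⟩
  · intro b hb hvb
    obtain ⟨c, hcB, rfl⟩ := hgen b hb hvb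
    refine ⟨fun i => c i * (∏ j, φ j ^ A i j)⁻¹, fun i => mul_mem (hcB i) (hPi φ i hφi),
      Finset.sum_congr rfl fun i _ => ?_⟩
    have h0 := hP0 φ i hφ0
    show c i * x i = c i * (∏ j, φ j ^ A i j)⁻¹ * ∏ j, (x' j * φ j) ^ A i j
    rw [hxx i]
    field_simp
  · intro j
    obtain ⟨hj0, hjO, hjv, a, b, ha, hb, hab⟩ := hx' j
    obtain ⟨a', ha', b', hb', -, hφab⟩ := mem_locAtCentre_iff.mp (hφB j)
    refine ⟨mul_ne_zero hj0 (hφ0 j), O'.mul_mem _ _ hjO (hBO (hφB j)), ?_, a * a', b * b',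
      M.mul_mem ha ha', M.mul_mem hb hb', ?_⟩
    · show O'.valuation (x' j * φ j) < 1
      rw [map_mul]
      exact mul_lt_one_of_lt_of_le hjv (hvB _ (hφB j))
    · show x' j * φ j = a * a' / (b * b')
      rw [hab, hφab, div_mul_div_comm]
  · intro j
    show σ (x' j * φ j) = x' j * φ j * (1 + (uu j₁ - 1)) ^ N j
    rw [add_sub_cancel, htw j]
  · refine ⟨j₁, fun e => hj₁ ?_⟩
    have e' : σ (x' j₁ * φ j₁) = x' j₁ * φ j₁ := e
    have h1 : uu j₁ ^ N j₁ = 1 :=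
      mul_left_cancel₀ (mul_ne_zero (hx'0 j₁) (hφ0 j₁)) ((htw j₁).symm.trans (e'.trans (mul_one _).symm))
    have hinv : IsUnitCoboundary B σ (uu j₁)⁻¹ :=
      ⟨φ j₁, hφ0 j₁, hφB j₁, hφi j₁, by rw [← hφe j₁, h1, one_div]⟩
    simpa only [inv_inv] using hinv.inv

end Model

/-! ## Directedness of the f.g. birational models -/
section Directed

variable (k : Type) [Field k] {K : Type} [Field K] [Algebra k K]

set_option maxHeartbeats 400000 in
/-- **MODELS ARE DIRECTED UPSTAIRS.**  `(R ⊔ k[s₀])[t] = R[t ∪ ι(s₀)]` inside `K′` (`ι : K → K′`): the model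
above the join of two f.g. birational models is a model above either of them with more adjoined elements.
[folklore] -/
theorem modelAbove_sup_adjoin_eq (R : Subalgebra k K) (s₀ : Finset K)
    (K' : IntermediateField K (AlgebraicClosure K)) [DecidableEq K'] (t : Finset K') :
    modelAbove k (R ⊔ Algebra.adjoin k (s₀ : Set K)) K' t =
      modelAbove k R K' (t ∪ s₀.image (algebraMap K K' : K →+* K')) := by
  classical
  set ι : K →+* K' := (algebraMap K K' : K →+* K') with hιdef
  set C : Subring K' := modelAbove k R K' (t ∪ s₀.image ι) with hCdef
  apply le_antisymm
  · refine Subring.closure_le.mpr (Set.union_subset ?_ fun z hz => ?_)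
    · rintro _ ⟨z, hz, rfl⟩
      let Ck : Subalgebra k K :=
        { carrier := {y | ι y ∈ C}
          mul_mem' := fun {a b} ha hb => by
            show ι (a * b) ∈ C
            rw [map_mul]; exact C.mul_mem ha hb
          one_mem' := by show ι 1 ∈ C; rw [map_one]; exact C.one_mem
          add_mem' := fun {a b} ha hb => by
            show ι (a + b) ∈ C
            rw [map_add]; exact C.add_mem ha hb
          zero_mem' := by show ι 0 ∈ C; rw [map_zero]; exact C.zero_mem
          algebraMap_mem' := fun c => Subring.subset_closure (Or.inl ⟨_, R.algebraMap_mem c, rfl⟩) }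
      have hR : R ≤ Ck := fun y hy => Subring.subset_closure (Or.inl ⟨y, hy, rfl⟩)
      have hs : Algebra.adjoin k (s₀ : Set K) ≤ Ck := Algebra.adjoin_le fun y hy =>
        Subring.subset_closure (Or.inr (by
          rw [Finset.coe_union, Finset.coe_image]
          exact Or.inr ⟨y, hy, rfl⟩))
      exact (sup_le hR hs) hz
    · exact Subring.subset_closure (Or.inr (by rw [Finset.coe_union]; exact Or.inl hz))
  · refine Subring.closure_le.mpr (Set.union_subset ?_ fun z hz => ?_)
    · rintro _ ⟨z, hz, rfl⟩
      exact Subring.subset_closure (Or.inl ⟨z, (le_sup_left : R ≤ R ⊔ Algebra.adjoin k (s₀ : Set K)) hz, rfl⟩)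
    · rw [Finset.coe_union, Finset.coe_image] at hz
      rcases hz with hz | ⟨y, hy, rfl⟩
      · exact Subring.subset_closure (Or.inr hz)
      · exact Subring.subset_closure (Or.inl ⟨y,
          (le_sup_right : Algebra.adjoin k (s₀ : Set K) ≤ R ⊔ Algebra.adjoin k (s₀ : Set K))
            (Algebra.subset_adjoin hy), rfl⟩)

end Directed

/-! ## THE EXACT CARVE and the LOCATION -/
section Carve

variable (k : Type) [Field k] {K : Type} [Field K] [Algebra k K]

variable {k}

set_option maxHeartbeats 1600000 in
/-- **`λ″ → λ₁ ∨ λ₂`.**  If above EVERY f.g. birational model some `G`-stable model carries a grade-1 frame, the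
place is `λ₁`.  Otherwise some `R₀` has none; then above any `R` take the `λ″`-model above the JOIN `R ⊔ R₀`
(directedness, `modelAbove_sup_adjoin_eq`): by the per-model dichotomy `cyclic_or_rankTwo` it is not grade 1
(it is a model above `R₀`), hence it carries an independent pair — and it is a model above `R`: the place is `λ₂`.
[folklore] -/
theorem wildLogCyclicAbove_or_wildLogRankTwoAbove {O : ValuationSubring K}
    (h : WildLogDiagonalMixedAbove k O) : WildLogCyclicAbove k O ∨ WildLogRankTwoAbove k O := by
  classical
  obtain ⟨K', hfd, hgal, hprime, hchar, O', hO'O, hGO', hκ', hLU⟩ := h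
  by_cases hall : ∀ R : Subalgebra k K, R.FG → IsFractionRing R K → R.toSubring ≤ O.toSubring →
      ∃ t₀ : Finset K', modelAbove k R K' t₀ ≤ O'.toSubring ∧
        (∀ g : K' ≃ₐ[K] K', ∀ y ∈ modelAbove k R K' t₀, g y ∈ modelAbove k R K' t₀) ∧
        IsRegularLocalRing (locAtCentre (modelAbove k R K' t₀) O') ∧
        ∃ d : ℕ, ∃ x x' : Fin d → K', ∃ A : Fin d → Fin d → ℕ, ∃ η : K', ∃ g : K' ≃ₐ[K] K', ∃ N : Fin d → ℤ,
          ringKrullDim (locAtCentre (modelAbove k R K' t₀) O') = d ∧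
          (∀ i, x i ∈ locAtCentre (modelAbove k R K' t₀) O' ∧ O'.valuation (x i) < 1) ∧
          (∀ b ∈ locAtCentre (modelAbove k R K' t₀) O', O'.valuation b < 1 →
            ∃ c : Fin d → K', (∀ i, c i ∈ locAtCentre (modelAbove k R K' t₀) O') ∧ b = ∑ i, c i * x i) ∧
          (∀ j, x' j ≠ 0 ∧ x' j ∈ O' ∧ O'.valuation (x' j) < 1 ∧
            ∃ a b : K', a ∈ modelAbove k R K' t₀ ∧ b ∈ modelAbove k R K' t₀ ∧ x' j = a / b) ∧
          (∀ i, x i = ∏ j, x' j ^ A i j) ∧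
          (η ∈ locAtCentre (modelAbove k R K' t₀) O' ∧ O'.valuation η < 1) ∧
          (∀ j, g (x' j) = x' j * (1 + η) ^ (N j)) ∧
          ∃ j, g (x' j) ≠ x' j
  · exact Or.inl ⟨K', hfd, hgal, hprime, hchar, O', hO'O, hGO', hκ', hall⟩
  right
  obtain ⟨R₀, hR₀⟩ := not_forall.mp hall
  obtain ⟨hR₀fg, hR₀⟩ := Classical.not_imp.mp hR₀
  obtain ⟨hR₀frac, hR₀⟩ := Classical.not_imp.mp hR₀
  obtain ⟨hR₀O, hnone⟩ := Classical.not_imp.mp hR₀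
  obtain ⟨s₀, rfl⟩ := hR₀fg
  refine ⟨K', hfd, hgal, hprime, hchar, O', hO'O, hGO', hκ', fun R hRfg hRfrac hRO => ?_⟩
  haveI := hfd
  haveI := hgal
  obtain ⟨s, rfl⟩ := hRfg
  -- the prime and the Galois data
  set p : ℕ := Module.finrank K K' with hpdef
  haveI hpF : Fact p.Prime := ⟨hprime⟩
  haveI : CharP k p := ringChar.of_eq (CharP.ringChar_of_prime_eq_zero hprime hchar)
  haveI : CharP K' p := charP_of_injective_algebraMap (algebraMap k K').injective p
  let ι : K →+* K' := (algebraMap K K' : K →+* K')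
  have hfk : ∀ c : k, ι (algebraMap k K c) = algebraMap k K' c := fun c =>
    (IsScalarTower.algebraMap_apply k K K' c).symm
  have hgk : ∀ (g : K' ≃ₐ[K] K') (c : k), g (algebraMap k K' c) = algebraMap k K' c := fun g c => by
    rw [← hfk]; exact g.commutes _
  have hcoe1 : ((1 : K' ≃ₐ[K] K') : K' ≃+* K') = 1 := RingEquiv.ext fun _ => rfl
  have hcoemul : ∀ g g' : K' ≃ₐ[K] K', ((g * g' : K' ≃ₐ[K] K') : K' ≃+* K') =
      (g : K' ≃+* K') * (g' : K' ≃+* K') := fun _ _ => RingEquiv.ext fun _ => rfl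
  have hcoepow : ∀ (g : K' ≃ₐ[K] K') (n : ℕ), ((g ^ n : K' ≃ₐ[K] K') : K' ≃+* K') = (g : K' ≃+* K') ^ n := by
    intro g n
    induction n with
    | zero => rw [pow_zero, pow_zero, hcoe1]
    | succ n ih => rw [pow_succ, pow_succ, hcoemul, ih]
  have hcard : Nat.card (K' ≃ₐ[K] K') = p := IsGalois.card_aut_eq_finrank K K'
  have hσp : ∀ g : K' ≃ₐ[K] K', (g : K' ≃+* K') ^ p = 1 := fun g => by
    have hgp : g ^ p = 1 := by rw [← hcard]; exact pow_card_eq_one'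
    rw [← hcoepow, hgp, hcoe1]
  -- the JOIN of the two models
  have hkO : ∀ c : k, algebraMap k K c ∈ O.toSubring := fun c => hRO ((Algebra.adjoin k (s : Set K)).algebraMap_mem c)
  let Ok : Subalgebra k K :=
    { carrier := {y | y ∈ O.toSubring}
      mul_mem' := fun {a b} ha hb => O.toSubring.mul_mem ha hb
      one_mem' := O.toSubring.one_mem
      add_mem' := fun {a b} ha hb => O.toSubring.add_mem ha hb
      zero_mem' := O.toSubring.zero_mem
      algebraMap_mem' := hkO }
  set R₁ : Subalgebra k K := Algebra.adjoin k (s : Set K) ⊔ Algebra.adjoin k (s₀ : Set K) with hR₁def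
  have hR₁fg : R₁.FG := (Subalgebra.fg_adjoin_finset s).sup (Subalgebra.fg_adjoin_finset s₀)
  have hR₁frac : IsFractionRing R₁ K := isFractionRing_of_le le_sup_left hRfrac
  have hR₁Ok : R₁ ≤ Ok := sup_le (fun y hy => hRO hy) (fun y hy => hR₀O hy)
  have hR₁O : R₁.toSubring ≤ O.toSubring := fun y hy => hR₁Ok hy
  obtain ⟨t₁, hMO, hGM, hreg, d, x, x', A, g, hdim, hx, hgen, hx', hmon, hu, hmv⟩ :=
    hLU R₁ hR₁fg hR₁frac hR₁O
  have hkM : ∀ c : k, algebraMap k K' c ∈ modelAbove k R₁ K' t₁ := fun c => by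
    rw [← hfk]
    exact Subring.subset_closure (Or.inl ⟨_, R₁.algebraMap_mem c, rfl⟩)
  rcases cyclic_or_rankTwo k p O' hκ' g (hGO' g) (hσp g) (hgk g) hMO (hGM g) hkM hreg hx hgen hx' hmon hu hmv
    with ⟨x₁, x₁', A₁, η, N, h1, h2, h3, h4, h5, h6, h7⟩ | ⟨j₁, j₂, hind⟩
  · -- a grade-1 frame above `R ⊔ R₀` is one above `R₀`: contradiction
    exfalso
    refine hnone ⟨t₁ ∪ s.image ι, ?_⟩
    have hEq : modelAbove k (Algebra.adjoin k (s₀ : Set K)) K' (t₁ ∪ s.image ι) = modelAbove k R₁ K' t₁ := by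
      rw [hR₁def, sup_comm]
      exact (modelAbove_sup_adjoin_eq k (Algebra.adjoin k (s₀ : Set K)) s K' t₁).symm
    rw [hEq]
    exact ⟨hMO, hGM, hreg, d, x₁, x₁', A₁, η, g, N, hdim, h1, h2, h3, h4, h5, h6, h7⟩
  · -- an independent pair above `R ⊔ R₀` is one above `R`
    refine ⟨t₁ ∪ s₀.image ι, ?_⟩
    have hEq : modelAbove k (Algebra.adjoin k (s : Set K)) K' (t₁ ∪ s₀.image ι) = modelAbove k R₁ K' t₁ :=
      (modelAbove_sup_adjoin_eq k (Algebra.adjoin k (s : Set K)) s₀ K' t₁).symm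
    rw [hEq]
    exact ⟨hMO, hGM, hreg, d, x, x', A, g, hdim, hx, hgen, hx', hmon, hu, hmv, j₁, j₂, hind⟩

/-- **THE EXACT CARVE** (hypothesis-free): the mixed-unit log-diagonal kind IS the union of its grade-1 part
`λ₁` (DECIDED, file 2) and its grade-≥2 part `λ₂` (UNDECIDED, typed with test data). [this node] -/
theorem wildLogDiagonalMixedAbove_iff {O : ValuationSubring K} :
    WildLogDiagonalMixedAbove k O ↔ WildLogCyclicAbove k O ∨ WildLogRankTwoAbove k O :=
  ⟨wildLogCyclicAbove_or_wildLogRankTwoAbove, fun h => h.elim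
    wildLogDiagonalMixedAbove_of_wildLogCyclicAbove wildLogDiagonalMixedAbove_of_wildLogRankTwoAbove⟩

/-- **LOCATION.**  The remainder of the log-diagonal world after the cyclic cut is GRADE ≥ 2 — by a theorem,
not by a census. [this node] -/
theorem wildLogRankTwoAbove_of_not_cyclic {O : ValuationSubring K} (h : WildLogDiagonalMixedAbove k O)
    (h₁ : ¬ WildLogCyclicAbove k O) : WildLogRankTwoAbove k O :=
  (wildLogCyclicAbove_or_wildLogRankTwoAbove h).resolve_left h₁

/-- Fully-qualified audit example: the carve, verbatim kinds. -/
example {O : ValuationSubring K} :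
    Summit.ResolutionOfSingularities.ResolutionOfSingularities.Theorems.WildLogDiagonalLU.WildLogDiagonalMixedAbove
        k O ↔
      Summit.ResolutionOfSingularities.ResolutionOfSingularities.Theorems.WildCocycleLU.WildLogCyclicAbove k O ∨
      Summit.ResolutionOfSingularities.ResolutionOfSingularities.Theorems.WildCocycleLU.WildLogRankTwoAbove k O :=
  wildLogDiagonalMixedAbove_iff

end Carve

end Summit.ResolutionOfSingularities.ResolutionOfSingularities.Theorems.WildCocycleLU

end
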